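import Mathlib
import Summits.NavierStokesRegularity.NavierStokesRegularity.Theorems.EulerZoomLiouvillePowerGaugeEulerLiouvilleDSSEndpointMember
import HarnessLib

/-!
# Rung C2 of the crux `EulerZoomLiouville.PowerGaugeEulerLiouville` at the endpoint `ρ = 1/2`:
# no DSS member with power spread on ONE period, ANY factor `l > 1`

Route №10 `EulerZoomLiouville` (NavierStokesRegularity), crux E = stmt-NavierStokesRegularity-19832,
tenure rung C2 (`Sig.rungC2_dss`) at the energy-conserving endpoint `ρ = 1/2`.  Polish of the closing
file `…DSSEndpointMember`: there the factor is `l ≥ 4` (or, for any `l > 1`, the power spread is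
asked on a period of a power `l^k ≥ 4`).  Here the power spread is TRANSPORTED along the orbit of
the class scaling, so one period of the factor itself suffices:

* `dss_half_transport_upper`, `dss_half_transport_lower` — for a DSS member at `ρ = 1/2`
  (`u(τ,y) = l^{3/2} u(l^{5/2}τ, l y)`, `l ≥ 1`), the far-field bounds on the period `(l^{5/2} s, s)`
  imply the same bounds (same constants; thresholds `R ↦ l^k |R|`) on the `k` periods
  `((l^{5/2})^k s, s)` — `|u(b^j τ, y)| = l^{−3j/2} |u(τ, y/l^j)|` (upper: `l^{−3j/2 − j(1−δ)} ≤ 1`;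
  lower: `l^{j(5/2 − δ')} ≥ 1` for `δ' ≤ 5/2`);
* `dss_half_false_of_powerSpread'` — E's three hypotheses at `ρ = 1/2` + DSS with ANY factor
  `l > 1` + power spread for a.e. slice of ONE period `(l^{2+ρ} τ₀, τ₀)` ⇒ `False`;
  `dss_half_ae_eq_zero_of_powerSpread'` — `Sig.rungC2_dss`-shaped.

WHAT THIS IS NOT: not NS, not E, not rung C2 — the same printed-type stratum (Chae–Shvydkoy Thm 3.1
for DSS collapse, weak class), with the bookkeeping restriction on the factor removed.
-/

noncomputable section

-- flat `Theorems/<Route><Decl>…` files of one crux share the namespace of the crux (tree convention)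
set_option linter.dupNamespace false

open MeasureTheory Set Filter Topology Metric Function TopologicalSpace
open scoped ENNReal NNReal InnerProductSpace RealInnerProductSpace

namespace Summit.NavierStokesRegularity.NavierStokesRegularity.Theorems.PowerGaugeEulerLiouville

open Literature.Analysis Literature.Analysis.FunctionSpaces Literature.Analysis.FluidPDE

section Transport

variable {u : ℝ → EuclideanSpace ℝ (Fin 3) → EuclideanSpace ℝ (Fin 3)}

/-- **One-step time/space dilation of an a.e. slice property.**  If `P τ y` holds for a.e. slice
`τ ∈ (b s, s)` and a.e. `y`, then `P (b⁻¹ τ) (l⁻¹ y)` holds for a.e. slice `τ ∈ (b² s, b s)` and a.e.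
`y` (`b, l > 0`: both dilations preserve null sets). [folklore] -/
theorem dss_ae_window_step {b l : ℝ} (hb : 0 < b) (hl : 0 < l) {s : ℝ}
    {P : ℝ → EuclideanSpace ℝ (Fin 3) → Prop}
    (h : ∀ᵐ τ : ℝ, τ ∈ Ioo (b * s) s → ∀ᵐ y ∂volume, P τ y) :
    ∀ᵐ τ : ℝ, τ ∈ Ioo (b * (b * s)) (b * s) →
      ∀ᵐ y ∂volume, P (b⁻¹ * τ) (l⁻¹ • (y : EuclideanSpace ℝ (Fin 3))) := by
  have h1 := ae_comp_mul_left h (inv_ne_zero hb.ne')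
  filter_upwards [h1] with τ hτ hτI
  have hmem : b⁻¹ * τ ∈ Ioo (b * s) s := by
    constructor
    · rw [lt_inv_mul_iff₀ hb]; exact hτI.1
    · rw [inv_mul_lt_iff₀ hb]; exact hτI.2
  exact (Measure.quasiMeasurePreserving_smul (μ := (volume : Measure (EuclideanSpace ℝ (Fin 3))))
    (inv_ne_zero hl.ne')).ae (hτ hmem)

/-- **Transport of the sublinear UPPER bound along the scaling orbit (endpoint).**  For a DSS member
at `ρ = 1/2` with factor `l ≥ 1` and every `k`: if `|u(τ, y)| ≤ C_up |y|^{1−δ}` (`δ ≤ 1`) for a.e.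
`τ` in the period `(l^{5/2} s, s)` and a.e. `|y| ≥ R`, then the same holds for a.e. `τ` in the
period `((l^{5/2})^{k+1} s, (l^{5/2})^k s)` and a.e. `|y| ≥ l^k R`. [folklore] -/
theorem dss_half_transport_upper {l : ℝ} (hl : 1 ≤ l)
    (hu : ∀ τ : ℝ, τ < 0 → ∀ y, u τ y = (l ^ (3 / 2 : ℝ)) • u (l ^ (5 / 2 : ℝ) * τ) (l • y))
    {s : ℝ} (hs : s ≤ 0) {δ Cup R : ℝ} (hδ1 : δ ≤ 1) (hCup : 0 ≤ Cup)
    (h : ∀ᵐ τ : ℝ, τ ∈ Ioo (l ^ (5 / 2 : ℝ) * s) s →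
      ∀ᵐ y ∂volume, R ≤ ‖y‖ → ‖u τ y‖ ≤ Cup * ‖y‖ ^ (1 - δ)) (k : ℕ) :
    ∀ᵐ τ : ℝ, τ ∈ Ioo ((l ^ (5 / 2 : ℝ)) ^ (k + 1) * s) ((l ^ (5 / 2 : ℝ)) ^ k * s) →
      ∀ᵐ y ∂volume, l ^ k * R ≤ ‖y‖ → ‖u τ y‖ ≤ Cup * ‖y‖ ^ (1 - δ) := by
  have hl0 : 0 < l := by linarith
  set b : ℝ := l ^ (5 / 2 : ℝ) with hb
  have hb0 : 0 < b := Real.rpow_pos_of_pos hl0 _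
  set a : ℝ := l ^ (3 / 2 : ℝ) with ha
  have ha0 : 0 < a := Real.rpow_pos_of_pos hl0 _
  have ha1 : 1 ≤ a := Real.one_le_rpow hl (by norm_num)
  induction k with
  | zero => simpa using h
  | succ k ih =>
    have hstep := dss_ae_window_step hb0 hl0 (s := b ^ k * s) (P := fun τ y =>
      l ^ k * R ≤ ‖y‖ → ‖u τ y‖ ≤ Cup * ‖y‖ ^ (1 - δ)) (by
        have e : b * (b ^ k * s) = b ^ (k + 1) * s := by ring
        rw [e]; exact ih)
    have e1 : b * (b * (b ^ k * s)) = b ^ (k + 1 + 1) * s := by ring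
    have e2 : b * (b ^ k * s) = b ^ (k + 1) * s := by ring
    rw [e1, e2] at hstep
    filter_upwards [hstep] with τ hτ hτI
    filter_upwards [hτ hτI] with y hy hyR
    -- `τ < 0` and the DSS relation between the slices `τ` and `b⁻¹ τ`
    have hbks : b ^ (k + 1) * s ≤ 0 := mul_nonpos_of_nonneg_of_nonpos (by positivity) hs
    have hτ0 : τ < 0 := lt_of_lt_of_le hτI.2 hbks
    have hτ0' : b⁻¹ * τ < 0 := mul_neg_of_pos_of_neg (inv_pos.2 hb0) hτ0
    have hrel : u τ y = a⁻¹ • u (b⁻¹ * τ) (l⁻¹ • y) := by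
      have h1 := hu (b⁻¹ * τ) hτ0' (l⁻¹ • y)
      rw [smul_smul, mul_inv_cancel₀ hl0.ne', one_smul, ← mul_assoc, mul_inv_cancel₀ hb0.ne',
        one_mul] at h1
      rw [h1, smul_smul, inv_mul_cancel₀ ha0.ne', one_smul]
    have hyl : ‖l⁻¹ • y‖ = ‖y‖ / l := by
      rw [norm_smul, norm_inv, Real.norm_eq_abs, abs_of_pos hl0, div_eq_inv_mul]
    have hyR' : l ^ k * R ≤ ‖l⁻¹ • y‖ := by
      rw [hyl, le_div_iff₀ hl0]
      calc l ^ k * R * l = l ^ (k + 1) * R := by ring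
        _ ≤ ‖y‖ := hyR
    have hy0 : 0 ≤ ‖y‖ / l := by positivity
    have hbound := hy hyR'
    rw [hrel, norm_smul, norm_inv, Real.norm_eq_abs, abs_of_pos ha0, hyl,
      Real.div_rpow (norm_nonneg _) hl0.le] at *
    -- `a⁻¹ Cup (‖y‖/l)^{1−δ} ≤ Cup ‖y‖^{1−δ}`
    calc a⁻¹ * ‖u (b⁻¹ * τ) (l⁻¹ • y)‖ ≤ a⁻¹ * (Cup * (‖y‖ ^ (1 - δ) / l ^ (1 - δ))) :=
          mul_le_mul_of_nonneg_left hbound (by positivity)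
      _ = (a⁻¹ * (l ^ (1 - δ))⁻¹) * (Cup * ‖y‖ ^ (1 - δ)) := by ring
      _ ≤ 1 * (Cup * ‖y‖ ^ (1 - δ)) := by
          refine mul_le_mul_of_nonneg_right ?_ (by positivity)
          have h1 : (1 : ℝ) ≤ l ^ (1 - δ) := Real.one_le_rpow hl (by linarith)
          calc a⁻¹ * (l ^ (1 - δ))⁻¹ ≤ 1⁻¹ * 1⁻¹ := by
                gcongr
            _ = 1 := by norm_num
      _ = Cup * ‖y‖ ^ (1 - δ) := one_mul _

/-- **Transport of the LOWER power bound along the scaling orbit (endpoint).**  For a DSS member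
at `ρ = 1/2` with factor `l ≥ 1` and every `k`: if `c₀ |y|^{−(4−δ')} ≤ |u(τ, y)|` (`δ' ≤ 5/2`,
`c₀ ≥ 0`) for a.e. `τ` in the period `(l^{5/2} s, s)` and a.e. `|y| ≥ R` (`R > 0`), then the same
holds for a.e. `τ` in `((l^{5/2})^{k+1} s, (l^{5/2})^k s)` and a.e. `|y| ≥ l^k R`. [folklore] -/
theorem dss_half_transport_lower {l : ℝ} (hl : 1 ≤ l)
    (hu : ∀ τ : ℝ, τ < 0 → ∀ y, u τ y = (l ^ (3 / 2 : ℝ)) • u (l ^ (5 / 2 : ℝ) * τ) (l • y))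
    {s : ℝ} (hs : s ≤ 0) {δ' c₀ R : ℝ} (hδ' : δ' ≤ 5 / 2) (hc₀ : 0 ≤ c₀) (hR : 0 < R)
    (h : ∀ᵐ τ : ℝ, τ ∈ Ioo (l ^ (5 / 2 : ℝ) * s) s →
      ∀ᵐ y ∂volume, R ≤ ‖y‖ → c₀ * ‖y‖ ^ (-(4 - δ')) ≤ ‖u τ y‖) (k : ℕ) :
    ∀ᵐ τ : ℝ, τ ∈ Ioo ((l ^ (5 / 2 : ℝ)) ^ (k + 1) * s) ((l ^ (5 / 2 : ℝ)) ^ k * s) →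
      ∀ᵐ y ∂volume, l ^ k * R ≤ ‖y‖ → c₀ * ‖y‖ ^ (-(4 - δ')) ≤ ‖u τ y‖ := by
  have hl0 : 0 < l := by linarith
  set b : ℝ := l ^ (5 / 2 : ℝ) with hb
  have hb0 : 0 < b := Real.rpow_pos_of_pos hl0 _
  set a : ℝ := l ^ (3 / 2 : ℝ) with ha
  have ha0 : 0 < a := Real.rpow_pos_of_pos hl0 _
  induction k with
  | zero => simpa using h
  | succ k ih =>
    have hstep := dss_ae_window_step hb0 hl0 (s := b ^ k * s) (P := fun τ y =>
      l ^ k * R ≤ ‖y‖ → c₀ * ‖y‖ ^ (-(4 - δ')) ≤ ‖u τ y‖) (by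
        have e : b * (b ^ k * s) = b ^ (k + 1) * s := by ring
        rw [e]; exact ih)
    have e1 : b * (b * (b ^ k * s)) = b ^ (k + 1 + 1) * s := by ring
    have e2 : b * (b ^ k * s) = b ^ (k + 1) * s := by ring
    rw [e1, e2] at hstep
    filter_upwards [hstep] with τ hτ hτI
    filter_upwards [hτ hτI] with y hy hyR
    have hbks : b ^ (k + 1) * s ≤ 0 := mul_nonpos_of_nonneg_of_nonpos (by positivity) hs
    have hτ0 : τ < 0 := lt_of_lt_of_le hτI.2 hbks
    have hτ0' : b⁻¹ * τ < 0 := mul_neg_of_pos_of_neg (inv_pos.2 hb0) hτ0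
    have hrel : u τ y = a⁻¹ • u (b⁻¹ * τ) (l⁻¹ • y) := by
      have h1 := hu (b⁻¹ * τ) hτ0' (l⁻¹ • y)
      rw [smul_smul, mul_inv_cancel₀ hl0.ne', one_smul, ← mul_assoc, mul_inv_cancel₀ hb0.ne',
        one_mul] at h1
      rw [h1, smul_smul, inv_mul_cancel₀ ha0.ne', one_smul]
    have hyl : ‖l⁻¹ • y‖ = ‖y‖ / l := by
      rw [norm_smul, norm_inv, Real.norm_eq_abs, abs_of_pos hl0, div_eq_inv_mul]
    have hypos : 0 < ‖y‖ := lt_of_lt_of_le (by positivity) hyR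
    have hyR' : l ^ k * R ≤ ‖l⁻¹ • y‖ := by
      rw [hyl, le_div_iff₀ hl0]
      calc l ^ k * R * l = l ^ (k + 1) * R := by ring
        _ ≤ ‖y‖ := hyR
    have hbound := hy hyR'
    rw [hyl, Real.div_rpow (norm_nonneg _) hl0.le] at hbound
    rw [hrel, norm_smul, norm_inv, Real.norm_eq_abs, abs_of_pos ha0]
    -- `c₀ ‖y‖^{-(4-δ')} ≤ a⁻¹ c₀ ‖y‖^{-(4-δ')} / l^{-(4-δ')}`, since `a⁻¹ l^{4-δ'} ≥ 1`
    have hkey : (1 : ℝ) ≤ a⁻¹ * (l ^ (-(4 - δ')))⁻¹ := by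
      rw [ha, ← Real.rpow_neg hl0.le, ← Real.rpow_neg hl0.le, neg_neg, ← Real.rpow_add hl0]
      exact Real.one_le_rpow hl (by linarith)
    have hpow0 : 0 < ‖y‖ ^ (-(4 - δ')) := Real.rpow_pos_of_pos hypos _
    calc c₀ * ‖y‖ ^ (-(4 - δ')) = 1 * (c₀ * ‖y‖ ^ (-(4 - δ'))) := (one_mul _).symm
      _ ≤ (a⁻¹ * (l ^ (-(4 - δ')))⁻¹) * (c₀ * ‖y‖ ^ (-(4 - δ'))) :=
          mul_le_mul_of_nonneg_right hkey (by positivity)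
      _ = a⁻¹ * (c₀ * (‖y‖ ^ (-(4 - δ')) / l ^ (-(4 - δ')))) := by ring
      _ ≤ a⁻¹ * ‖u (b⁻¹ * τ) (l⁻¹ • y)‖ := mul_le_mul_of_nonneg_left hbound (by positivity)

/-- **From one period to `k` periods.**  An a.e. slice property indexed by thresholds `l^j R`
(`j < k`) on the periods `((l^{5/2})^{j+1} s, (l^{5/2})^j s)` holds, with threshold `l^k R`, for a.e.
slice of the window `((l^{5/2})^k s, s)` (`s < 0`, `l > 1`, `R ≥ 0`; the period endpoints are a
countable null set). [folklore] -/
theorem ae_window_of_periods {l : ℝ} (hl : 1 < l) {s : ℝ} (hs : s < 0) {R : ℝ} (hR : 0 ≤ R)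
    {Q : ℝ → EuclideanSpace ℝ (Fin 3) → Prop} {k : ℕ}
    (h : ∀ j : ℕ, ∀ᵐ τ : ℝ, τ ∈ Ioo ((l ^ (5 / 2 : ℝ)) ^ (j + 1) * s) ((l ^ (5 / 2 : ℝ)) ^ j * s) →
      ∀ᵐ y ∂volume, l ^ j * R ≤ ‖y‖ → Q τ y) :
    ∀ᵐ τ : ℝ, τ ∈ Ioo ((l ^ (5 / 2 : ℝ)) ^ k * s) s → ∀ᵐ y ∂volume, l ^ k * R ≤ ‖y‖ → Q τ y := by
  have hl0 : 0 < l := by linarith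
  set b : ℝ := l ^ (5 / 2 : ℝ) with hb
  have hb1 : 1 < b := Real.one_lt_rpow hl (by norm_num)
  have hb0 : 0 < b := by linarith
  have hN : ∀ᵐ τ : ℝ, τ ∉ Set.range (fun j : ℕ => b ^ j * s) :=
    (Set.countable_range _).ae_notMem _
  filter_upwards [ae_all_iff.2 h, hN] with τ hτ hτN hτI
  -- locate the period containing `τ`
  have hr1 : 1 ≤ τ / s := by rw [le_div_iff_of_neg hs, one_mul]; exact hτI.2.le
  obtain ⟨j, hj1, hj2⟩ := exists_nat_pow_near hr1 hb1
  have hjk : j < k := by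
    by_contra hjk
    rw [not_lt] at hjk
    have h1 : b ^ k ≤ b ^ j := pow_le_pow_right₀ hb1.le hjk
    have h2 : τ / s < b ^ k := by rw [div_lt_iff_of_neg hs]; exact hτI.1
    linarith
  have hne : τ ≠ b ^ j * s := fun h => hτN ⟨j, h.symm⟩
  have hmem : τ ∈ Ioo (b ^ (j + 1) * s) (b ^ j * s) := by
    constructor
    · have := hj2; rw [div_lt_iff_of_neg hs] at this; exact this
    · have h1 : b ^ j * s ≥ τ := by
        have := hj1; rw [le_div_iff_of_neg hs] at this; exact this
      exact lt_of_le_of_ne h1 hne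
  filter_upwards [hτ j hmem] with y hy hyR
  refine hy (le_trans ?_ hyR)
  exact mul_le_mul_of_nonneg_right (pow_le_pow_right₀ hl.le hjk.le) hR

end Transport

section AnyFactor

variable {u : ℝ → EuclideanSpace ℝ (Fin 3) → EuclideanSpace ℝ (Fin 3)}
  {p : ℝ → EuclideanSpace ℝ (Fin 3) → ℝ}
  {H : ℝ → EuclideanSpace ℝ (Fin 3) → EuclideanSpace ℝ (Fin 3) →L[ℝ] EuclideanSpace ℝ (Fin 3)}
  {c : ℝ≥0}

/-- **No DSS member with power spread on ONE period, any factor (Chae–Shvydkoy Thm 3.1 for DSS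
collapse, weak class).**  Let `(u, p, H, c)` satisfy the three hypotheses of the crux at `ρ = 1/2`
and be discretely self-similar with ANY factor `l > 1` (`IsDSSPair` shape).  If for a.e. slice of ONE
period `(l^{2+ρ} τ₀, τ₀)` the profile has the power spread `c₀ |y|^{−(4−δ')} ≤ |u(τ, y)| ≤ C_up |y|^{1−δ}`
a.e. for large `|y|` (`δ, δ', c₀ > 0`, `δ ≤ 1`), then `False`.  (Transport of the two bounds to the
`k` periods of a power `l^k ≥ 4`, then `dss_half_false_of_powerSpread`.)
[cite: ChaeShvydkoy2013, §3.1 Thm. 3.1; Xue2014DSSEuler, Thm 1.1 (ii)] -/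
theorem dss_half_false_of_powerSpread' {ρ : ℝ} (hρ : ρ = 1 / 2)
    (hsw : IsSuitableWeakSolutionOn (slab (EuclideanSpace ℝ (Fin 3)) (Iio 0) isOpen_Iio) 0 0 u p)
    (hH : HasWeakSpatialGradientOn (slab (EuclideanSpace ℝ (Fin 3)) (Iio 0) isOpen_Iio) u H)
    (hgauge : ∀ a : ℝ, 0 < a →
      ENNReal.ofReal (a ^ (2 * ρ)) * cknA a (0 : ℝ × EuclideanSpace ℝ (Fin 3)) u +
          ENNReal.ofReal (a ^ ρ) * cknE a (0 : ℝ × EuclideanSpace ℝ (Fin 3)) H +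
        ENNReal.ofReal (a ^ (2 * ρ)) * cknD a (0 : ℝ × EuclideanSpace ℝ (Fin 3)) p ≤ (c : ℝ≥0∞))
    {l : ℝ} (hl : 1 < l)
    (hu : ∀ τ : ℝ, τ < 0 → ∀ y, u τ y = (l ^ (1 + ρ)) • u ((l ^ (2 + ρ)) * τ) (l • y))
    (hp : ∀ τ : ℝ, τ < 0 → ∀ y, p τ y = (l ^ (2 * (1 + ρ))) * p ((l ^ (2 + ρ)) * τ) (l • y))
    {τ₀ : ℝ} (hτ₀ : τ₀ < 0)
    {δ Cup R₀ : ℝ} (hδ : 0 < δ) (hδ1 : δ ≤ 1) (hCup : 0 ≤ Cup)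
    (hup : ∀ᵐ τ : ℝ, τ ∈ Ioo ((l ^ (2 + ρ)) * τ₀) τ₀ →
      ∀ᵐ y ∂volume, R₀ ≤ ‖y‖ → ‖u τ y‖ ≤ Cup * ‖y‖ ^ (1 - δ))
    {c₀ δ' R₀' : ℝ} (hc₀ : 0 < c₀) (hδ' : 0 < δ')
    (hlow : ∀ᵐ τ : ℝ, τ ∈ Ioo ((l ^ (2 + ρ)) * τ₀) τ₀ →
      ∀ᵐ y ∂volume, R₀' ≤ ‖y‖ → c₀ * ‖y‖ ^ (-(4 - δ')) ≤ ‖u τ y‖) : False := by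
  subst hρ
  have hl0 : 0 < l := by linarith
  obtain ⟨k, hk⟩ := pow_unbounded_of_one_lt (4 : ℝ) hl
  -- the scaling at `ρ = 1/2`
  have e1 : (1 : ℝ) + 1 / 2 = 3 / 2 := by norm_num
  have e2 : (2 : ℝ) + 1 / 2 = 5 / 2 := by norm_num
  have hu' : ∀ τ : ℝ, τ < 0 → ∀ y, u τ y = (l ^ (3 / 2 : ℝ)) • u (l ^ (5 / 2 : ℝ) * τ) (l • y) := by
    intro τ hτ y; rw [hu τ hτ y, e1, e2]
  rw [e2] at hup hlow
  have eb : (l ^ k) ^ (2 + 1 / 2 : ℝ) = (l ^ (5 / 2 : ℝ)) ^ k := by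
    rw [e2, ← Real.rpow_natCast l k, ← Real.rpow_mul hl0.le, ← Real.rpow_natCast (l ^ (5 / 2 : ℝ)) k,
      ← Real.rpow_mul hl0.le, mul_comm]
  -- thresholds and the lower exponent
  have hup0 : ∀ᵐ τ : ℝ, τ ∈ Ioo (l ^ (5 / 2 : ℝ) * τ₀) τ₀ →
      ∀ᵐ y ∂volume, max R₀ 0 ≤ ‖y‖ → ‖u τ y‖ ≤ Cup * ‖y‖ ^ (1 - δ) := by
    filter_upwards [hup] with τ hτ hτI
    filter_upwards [hτ hτI] with y hy hyR
    exact hy ((le_max_left _ _).trans hyR)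
  have hlow0 : ∀ᵐ τ : ℝ, τ ∈ Ioo (l ^ (5 / 2 : ℝ) * τ₀) τ₀ →
      ∀ᵐ y ∂volume, max R₀' 1 ≤ ‖y‖ → c₀ * ‖y‖ ^ (-(4 - min δ' 1)) ≤ ‖u τ y‖ := by
    filter_upwards [hlow] with τ hτ hτI
    filter_upwards [hτ hτI] with y hy hyR
    have hy1 : 1 ≤ ‖y‖ := (le_max_right _ _).trans hyR
    refine le_trans ?_ (hy ((le_max_left _ _).trans hyR))
    exact mul_le_mul_of_nonneg_left
      (Real.rpow_le_rpow_of_exponent_le hy1 (by linarith [min_le_left δ' 1])) hc₀.le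
  -- transport to `k` periods
  have hupk := fun j => dss_half_transport_upper hl.le hu' hτ₀.le hδ1 hCup hup0 j
  have hlowk := fun j => dss_half_transport_lower hl.le hu' hτ₀.le
    (by linarith [min_le_right δ' 1] : min δ' 1 ≤ 5 / 2) hc₀.le (by positivity : (0 : ℝ) < max R₀' 1)
    hlow0 j
  have hupW := ae_window_of_periods hl hτ₀ (le_max_right R₀ 0) (k := k) hupk
  have hlowW := ae_window_of_periods hl hτ₀ (by positivity : (0 : ℝ) ≤ max R₀' 1) (k := k) hlowk
  rw [← eb] at hupW hlowW
  -- the member is DSS with factor `l^k ≥ 4`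
  obtain ⟨huk, hpk⟩ := dss_iterate hl0 hu hp k
  exact dss_half_false_of_powerSpread (ρ := 1 / 2) rfl hsw hH hgauge hk.le huk hpk hτ₀ hδ hδ1 hCup
    hupW hc₀ (lt_min hδ' one_pos) hlowW

/-- **The DSS power-spread stratum of rung C2 at the endpoint, any factor, `Sig.rungC2_dss`-shaped.**
[cite: ChaeShvydkoy2013, §3.1 Thm. 3.1] -/
theorem dss_half_ae_eq_zero_of_powerSpread' {ρ : ℝ} (hρ : ρ = 1 / 2)
    (hsw : IsSuitableWeakSolutionOn (slab (EuclideanSpace ℝ (Fin 3)) (Iio 0) isOpen_Iio) 0 0 u p)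
    (hH : HasWeakSpatialGradientOn (slab (EuclideanSpace ℝ (Fin 3)) (Iio 0) isOpen_Iio) u H)
    (hgauge : ∀ a : ℝ, 0 < a →
      ENNReal.ofReal (a ^ (2 * ρ)) * cknA a (0 : ℝ × EuclideanSpace ℝ (Fin 3)) u +
          ENNReal.ofReal (a ^ ρ) * cknE a (0 : ℝ × EuclideanSpace ℝ (Fin 3)) H +
        ENNReal.ofReal (a ^ (2 * ρ)) * cknD a (0 : ℝ × EuclideanSpace ℝ (Fin 3)) p ≤ (c : ℝ≥0∞))
    {l : ℝ} (hl : 1 < l)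
    (hu : ∀ τ : ℝ, τ < 0 → ∀ y, u τ y = (l ^ (1 + ρ)) • u ((l ^ (2 + ρ)) * τ) (l • y))
    (hp : ∀ τ : ℝ, τ < 0 → ∀ y, p τ y = (l ^ (2 * (1 + ρ))) * p ((l ^ (2 + ρ)) * τ) (l • y))
    {τ₀ : ℝ} (hτ₀ : τ₀ < 0)
    {δ Cup R₀ : ℝ} (hδ : 0 < δ) (hδ1 : δ ≤ 1) (hCup : 0 ≤ Cup)
    (hup : ∀ᵐ τ : ℝ, τ ∈ Ioo ((l ^ (2 + ρ)) * τ₀) τ₀ →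
      ∀ᵐ y ∂volume, R₀ ≤ ‖y‖ → ‖u τ y‖ ≤ Cup * ‖y‖ ^ (1 - δ))
    {c₀ δ' R₀' : ℝ} (hc₀ : 0 < c₀) (hδ' : 0 < δ')
    (hlow : ∀ᵐ τ : ℝ, τ ∈ Ioo ((l ^ (2 + ρ)) * τ₀) τ₀ →
      ∀ᵐ y ∂volume, R₀' ≤ ‖y‖ → c₀ * ‖y‖ ^ (-(4 - δ')) ≤ ‖u τ y‖) :
    uncurry u =ᵐ[volume.restrict (Iio (0 : ℝ) ×ˢ (univ : Set (EuclideanSpace ℝ (Fin 3))))] 0 :=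
  (dss_half_false_of_powerSpread' hρ hsw hH hgauge hl hu hp hτ₀ hδ hδ1 hCup hup hc₀ hδ' hlow).elim

end AnyFactor

end Summit.NavierStokesRegularity.NavierStokesRegularity.Theorems.PowerGaugeEulerLiouville
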